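import Summits.CriticalPhenomena.CardyFormulaZ2.Theorems.CardyIKTransportIKMixedBoxCrossingQuenchedBridgeFamily
import Summits.CriticalPhenomena.CardyFormulaZ2.Theorems.CardyIKTransportIKMixedBoxCrossingQuenchedTelescoping
import Summits.CriticalPhenomena.CardyFormulaZ2.Theorems.CardyIKTransportIKMixedBoxCrossingQuenchedAnnealedBound

/-!
# Stub `stub_approxHarrisFamOfVariance` — the composition (F) (line `defect-closure-exploration` v8 / ALT line
# `quenched-chain-fkg`, crux `IKMixedBoxCrossing`, stmt-CriticalPhenomena-5911)

Support file (`--supports stmt-CriticalPhenomena-5911`): the registered stub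
`stub_approxHarrisFamOfVariance : ApproxHarrisFamOfVariance` (`= QuenchedMixture → QuenchedHarris → QuenchedVarianceDecay →
ApproxHarrisFam`) of `…QuenchedVarianceDefs`.  Pure plumbing of the quenched layer:

* RECENTRING (§1, gauge side only): the joint law of finitely many box events is covariant under lattice translations with the
  pattern shifted along (`exists_lift_hshift`, `exists_lift_vshift`, shift covariance of `lrCross`/`tbCross`), so the `k` boxes may
  be placed in a cell rectangle `Λ₀ = [0, W) × [0, H)` at the origin;
* BRIDGE (landed `quenched_bridge_family`, `…QuenchedBridgeFamily`): `μIK(∩ᵢ boxEvent) = ∑_{c ⊆ F} 2^{-|F|} colourLaw(∩ᵢ boxFamilyᵢ c)`,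
  `F = facesIn S Λ₀`;
* ANNEALED BOUND coin by coin (landed `stub_annealedQuenchedBound` from (M), (H)): the families `boxFamilyᵢ c` are up-sets
  (`boxFamily_upper`: more black cells, same triangulation ⇒ more open edges, `isUpperSet_openCrossing`), so each colour-law term
  dominates `∑_D ∑_v envW ∏ᵢ P_{(D,v)}(boxFamilyᵢ c)`;
* TELESCOPING (landed `telescoping_sqrt_bound`, `…QuenchedTelescoping`) on the probability space (coins × defects × patterns) with
  weights `2^{-|F|} envW` (nonnegative, total mass one by (M) and the total masses of the quenched weights and of the colour law,
  `sum_env_one`), the quenched crossing probabilities being in `[0, 1]`: `≥ ∏ᵢ boxProbᵢ − ∑ᵢ √envVarianceᵢ`;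
* (V) at `η' = (η/(k+1))²` bounds each standard deviation by `η/(k+1)`.
No new definitions.
-/

noncomputable section

namespace Summit.CriticalPhenomena.CardyFormulaZ2.Cruxes.IKMixedBoxCrossing.QuenchedChainFKG

open scoped Classical BigOperators
open MeasureTheory Finset
open Literature.Probability.Percolation Literature.Probability.LatticeModels
open Summit.CriticalPhenomena.CardyFormulaZ2.Theorems.IKLinearTransport.PinnedDiagramExchange
  (Ω μIK Obs obs blackEdges lrCross tbCross exists_lift_vshift)
open Summit.CriticalPhenomena.CardyFormulaZ2.Theorems.IKLinearTransport.PinnedDiagramExchange.CouplingToLimits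
  (isProbabilityMeasure_μIK)
open Summit.CriticalPhenomena.CardyFormulaZ2.Cruxes.IKMixedBoxCrossing.PairedMirrorExploration.StubPatternLocality
  (shiftObs shiftObs_mem_lrCross shiftObs_mem_tbCross vshift_eq_shiftObs exists_lift_hshift real_preimage_obs_eq)
open Summit.CriticalPhenomena.CardyFormulaZ2.Cruxes.IKMixedBoxCrossing.PairedMirrorExploration.DualityStub
  (measurableSet_lrCross measurableSet_tbCross)
open Summit.CriticalPhenomena.CardyFormulaZ2.Cruxes.IKMixedBoxCrossing.DefectClosureExploration
  (facesIn colourLaw cellRect facesIn_subset_innerVertices)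

namespace FamOfVariance

/-! ## §1 Recentring of the gauge side -/

/-- The box crossing events are measurable. -/
theorem measurableSet_boxSet (lr : Bool) (a b : ℤ) (w h : ℕ) :
    MeasurableSet (if lr then lrCross a b w h else tbCross a b w h) := by
  cases lr
  exacts [measurableSet_tbCross a b w h, measurableSet_lrCross a b w h]

/-- Shift covariance of a box crossing event (either kind). -/
theorem shiftObs_mem_boxSet (t : Site 2) (lr : Bool) (a b : ℤ) (w h : ℕ) (x : Obs) :
    shiftObs t x ∈ (if lr then lrCross (a + t 0) (b + t 1) w h else tbCross (a + t 0) (b + t 1) w h) ↔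
      x ∈ (if lr then lrCross a b w h else tbCross a b w h) := by
  cases lr
  exacts [shiftObs_mem_tbCross t a b w h x, shiftObs_mem_lrCross t a b w h x]

/-- RECENTRING OF A FAMILY (gauge side): the joint probability of `k` box events for the pattern `S` equals that of the
boxes translated by `(-a₀, -b₀)` for the shifted pattern `{x | x + a₀ ∈ S}` (horizontal and vertical re-anchorings of the
gauge, `exists_lift_hshift` / `exists_lift_vshift`, and shift covariance of the box events). -/
theorem real_iInter_boxEvent_recentre (S : Set ℤ) (a₀ b₀ : ℤ) (k : ℕ) (bs : Fin k → BoxSpec) :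
    μIK.real (⋂ i, boxEvent S (bs i)) =
      μIK.real (⋂ i, boxEvent {x | x + a₀ ∈ S} ⟨(bs i).lr, (bs i).a - a₀, (bs i).b - b₀, (bs i).w, (bs i).h⟩) := by
  obtain ⟨Φ, hΦ, hobs⟩ := exists_lift_hshift S (-a₀)
  obtain ⟨Ψ, hΨ, hobs'⟩ := exists_lift_vshift {x | x + a₀ ∈ S} (-b₀)
  simp only [sub_neg_eq_add] at hobs
  simp only [vshift_eq_shiftObs] at hobs'
  have e : ∀ (T : Set ℤ) (cs : Fin k → BoxSpec), (⋂ i, boxEvent T (cs i)) =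
      obs T ⁻¹' ⋂ i, (if (cs i).lr then lrCross (cs i).a (cs i).b (cs i).w (cs i).h
        else tbCross (cs i).a (cs i).b (cs i).w (cs i).h) := fun T cs => by
    rw [Set.preimage_iInter]
    rfl
  have h1 : ∀ x : Obs, shiftObs ![-a₀, 0] x ∈ (⋂ i, (if (bs i).lr then lrCross ((bs i).a - a₀) (bs i).b (bs i).w (bs i).h
      else tbCross ((bs i).a - a₀) (bs i).b (bs i).w (bs i).h)) ↔
        x ∈ ⋂ i, (if (bs i).lr then lrCross (bs i).a (bs i).b (bs i).w (bs i).h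
          else tbCross (bs i).a (bs i).b (bs i).w (bs i).h) := fun x => by
    simp only [Set.mem_iInter]
    refine forall_congr' fun i => ?_
    simpa only [Matrix.cons_val_zero, Matrix.cons_val_one, Matrix.cons_val_fin_one, add_zero, ← sub_eq_add_neg] using
      shiftObs_mem_boxSet ![-a₀, 0] (bs i).lr (bs i).a (bs i).b (bs i).w (bs i).h x
  have h2 : ∀ x : Obs, shiftObs ![0, -b₀] x ∈ (⋂ i, (if (bs i).lr then lrCross ((bs i).a - a₀) ((bs i).b - b₀) (bs i).w (bs i).h
      else tbCross ((bs i).a - a₀) ((bs i).b - b₀) (bs i).w (bs i).h)) ↔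
        x ∈ ⋂ i, (if (bs i).lr then lrCross ((bs i).a - a₀) (bs i).b (bs i).w (bs i).h
          else tbCross ((bs i).a - a₀) (bs i).b (bs i).w (bs i).h) := fun x => by
    simp only [Set.mem_iInter]
    refine forall_congr' fun i => ?_
    simpa only [Matrix.cons_val_zero, Matrix.cons_val_one, Matrix.cons_val_fin_one, add_zero, ← sub_eq_add_neg] using
      shiftObs_mem_boxSet ![0, -b₀] (bs i).lr ((bs i).a - a₀) (bs i).b (bs i).w (bs i).h x
  rw [e, e]
  exact (real_preimage_obs_eq hΦ hobs (MeasurableSet.iInter fun i => measurableSet_boxSet _ _ _ _ _) h1).trans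
    (real_preimage_obs_eq hΨ hobs' (MeasurableSet.iInter fun i => measurableSet_boxSet _ _ _ _ _) h2)

/-- RECENTRING OF ONE BOX: the annealed crossing probability is translation covariant (pattern shifted along). -/
theorem boxProb_recentre (S : Set ℤ) (a₀ b₀ : ℤ) (bs : BoxSpec) :
    boxProb S bs = boxProb {x | x + a₀ ∈ S} ⟨bs.lr, bs.a - a₀, bs.b - b₀, bs.w, bs.h⟩ := by
  have h := real_iInter_boxEvent_recentre S a₀ b₀ 1 (fun _ => bs)
  simp only [Set.iInter_const] at h
  exact h

/-! ## §2 The box families are increasing; the environment sums -/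

/-- At fixed coins the black-set family of a box event is an UP-SET within `Λ.powerset` (more black cells, same
triangulation: more open edges, and open crossings are increasing). -/
theorem boxFamily_upper (S : Set ℤ) (Λ : Finset (Site 2)) (bs : BoxSpec) (c : Finset (Site 2)) :
    boxFamily S Λ bs c ⊆ Λ.powerset ∧ ∀ s ∈ boxFamily S Λ bs c, ∀ t ⊆ Λ, s ⊆ t → t ∈ boxFamily S Λ bs c := by
  refine ⟨Finset.filter_subset _ _, fun s hs t ht hst => ?_⟩
  rw [boxFamily, Finset.mem_filter] at hs ⊢
  refine ⟨Finset.mem_powerset.2 ht, ?_⟩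
  have hsub : blackEdges (finObs S s c) ⊆ blackEdges (finObs S t c) := by
    rintro e ⟨u, v, he, hu, hv, hR⟩
    exact ⟨u, v, he, hst hu, hst hv, hR⟩
  obtain ⟨-, hs⟩ := hs
  split_ifs at hs ⊢
  · exact isUpperSet_openCrossing _ _ _ hsub hs
  · exact isUpperSet_openCrossing _ _ _ hsub hs

/-- The environment average `∑_c 2^{-|F|} ∑_D ∑_v envW · φ` as ONE weighted finite sum (coins × (defects, pattern)). -/
theorem sum_env_eq (S : Set ℤ) (Λ : Finset (Site 2)) (r : ℝ)
    (φ : Finset (Site 2) → Finset (Site 2) → (Finset (Site 2) → Finset (Site 2)) → ℝ) :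
    ∑ c ∈ (facesIn S Λ).powerset, r * ∑ D ∈ (facesIn S Λ).powerset, ∑ v ∈ patterns D, envW S Λ D * φ c D v =
      ∑ x ∈ (facesIn S Λ).powerset ×ˢ (facesIn S Λ).powerset.sigma (fun D => patterns D),
        (r * envW S Λ x.2.1) * φ x.1 x.2.1 x.2.2 := by
  rw [Finset.sum_product]
  refine Finset.sum_congr rfl fun c _ => ?_
  rw [Finset.mul_sum, Finset.sum_sigma]
  refine Finset.sum_congr rfl fun D _ => ?_
  rw [Finset.mul_sum]
  exact Finset.sum_congr rfl fun v _ => by ring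

/-- TOTAL MASS of the environment weights (from (M) at the full family, the total mass of the quenched weights and of the
colour law): `∑_c 2^{-|F|} ∑_D ∑_v envW = 1`. -/
theorem sum_env_one (hM : QuenchedMixture) (S : Set ℤ) (Λ : Finset (Site 2)) :
    ∑ _c ∈ (facesIn S Λ).powerset, ((1 : ℝ) / 2) ^ (facesIn S Λ).card *
      ∑ D ∈ (facesIn S Λ).powerset, ∑ _v ∈ patterns D, envW S Λ D = 1 := by
  haveI : IsProbabilityMeasure (colourLaw S Λ) := by unfold colourLaw; infer_instance
  have hmass : ∑ D ∈ (facesIn S Λ).powerset, ∑ _v ∈ patterns D, envW S Λ D = 1 := by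
    have h := hM S Λ Λ.powerset (Finset.Subset.refl _)
    rw [Finset.sum_congr rfl fun D hD => Finset.sum_congr rfl fun v hv => by
      rw [quenchedProb_powerset D Λ ((Finset.mem_powerset.1 hD).trans (facesIn_subset_innerVertices S Λ)) v hv,
        mul_one]] at h
    rw [← h, ← measureReal_def, ← probReal_univ (μ := colourLaw S Λ)]
    exact measureReal_congr (ae_eq_univ.2 (BridgeFamily.colourLaw_compl_image S Λ))
  rw [Finset.sum_congr rfl fun c _ => by rw [hmass, mul_one], Finset.sum_const, Finset.card_powerset, nsmul_eq_mul,
    Nat.cast_pow, Nat.cast_two, ← mul_pow]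
  norm_num

end FamOfVariance

open FamOfVariance AnnealedBound

/-- **Registered stub `stub_approxHarrisFamOfVariance`** ((F): exact mixture (M) + quenched Harris (H) + variance decay (V) ⇒
`ApproxHarrisFam`).  Given `k`, `η`: take `n₀` from (V) at `η' = (η/(k+1))²`; recentre the `k` boxes into a cell rectangle
`Λ₀ = [0, W) × [0, H)` at the origin (gauge covariance); bridge `μIK(∩) = ∑_c 2^{-|F|} colourLaw(∩_i boxFamily_i c)`
(`quenched_bridge_family`); bound each colour-law term below by `∑_D ∑_v envW ∏_i P_{(D,v)}(boxFamily_i c)` (annealed bound (A)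
from (M), (H): the families are up-sets); the weights `2^{-|F|} envW` are a probability on (coins, defects, patterns), the quenched
crossing probabilities lie in `[0, 1]`, so telescoping gives `≥ ∏_i boxProb_i − ∑_i √envVariance_i ≥ ∏_i boxProb_i − k η/(k+1)`. -/
theorem stub_approxHarrisFamOfVariance : ApproxHarrisFamOfVariance := by
  intro hM hH hV k η hη
  haveI := isProbabilityMeasure_μIK
  obtain ⟨n₀, hn₀⟩ := hV ((η / (k + 1)) ^ 2) (by positivity)
  refine ⟨n₀, fun S n hn bs hbs => ?_⟩
  -- the bounding cell rectangle and the recentred data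
  obtain ⟨a₀, ha₀⟩ : ∃ a₀ : ℤ, a₀ = -∑ j, |(bs j).a| := ⟨_, rfl⟩
  obtain ⟨b₀, hb₀⟩ : ∃ b₀ : ℤ, b₀ = -∑ j, |(bs j).b| := ⟨_, rfl⟩
  obtain ⟨W, hW⟩ : ∃ W : ℕ, W = ∑ j, (2 * ((bs j).a).natAbs + (bs j).w) := ⟨_, rfl⟩
  obtain ⟨H, hH'⟩ : ∃ H : ℕ, H = ∑ j, (2 * ((bs j).b).natAbs + (bs j).h) := ⟨_, rfl⟩
  obtain ⟨S', hS'⟩ : ∃ S' : Set ℤ, S' = {x | x + a₀ ∈ S} := ⟨_, rfl⟩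
  obtain ⟨bs', hbs'⟩ : ∃ bs' : Fin k → BoxSpec,
      bs' = fun i => ⟨(bs i).lr, (bs i).a - a₀, (bs i).b - b₀, (bs i).w, (bs i).h⟩ := ⟨_, rfl⟩
  have hin : ∀ i, (bs' i).Inside 0 0 W H := fun i => by
    have h1 : |(bs i).a| ≤ ∑ j, |(bs j).a| :=
      Finset.single_le_sum (f := fun j => |(bs j).a|) (fun j _ => abs_nonneg _) (Finset.mem_univ i)
    have h2 : |(bs i).a| + ((bs i).w : ℤ) ≤ ∑ j, (|(bs j).a| + ((bs j).w : ℤ)) :=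
      Finset.single_le_sum (f := fun j => |(bs j).a| + ((bs j).w : ℤ)) (fun j _ => by positivity) (Finset.mem_univ i)
    have h3 : |(bs i).b| ≤ ∑ j, |(bs j).b| :=
      Finset.single_le_sum (f := fun j => |(bs j).b|) (fun j _ => abs_nonneg _) (Finset.mem_univ i)
    have h4 : |(bs i).b| + ((bs i).h : ℤ) ≤ ∑ j, (|(bs j).b| + ((bs j).h : ℤ)) :=
      Finset.single_le_sum (f := fun j => |(bs j).b| + ((bs j).h : ℤ)) (fun j _ => by positivity) (Finset.mem_univ i)
    have hWz : (W : ℤ) = ∑ j, |(bs j).a| + ∑ j, (|(bs j).a| + ((bs j).w : ℤ)) := by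
      rw [hW, ← Finset.sum_add_distrib]
      push_cast
      exact Finset.sum_congr rfl fun j _ => by ring
    have hHz : (H : ℤ) = ∑ j, |(bs j).b| + ∑ j, (|(bs j).b| + ((bs j).h : ℤ)) := by
      rw [hH', ← Finset.sum_add_distrib]
      push_cast
      exact Finset.sum_congr rfl fun j _ => by ring
    have ha := le_abs_self (bs i).a
    have ha' := neg_abs_le (bs i).a
    have hb := le_abs_self (bs i).b
    have hb' := neg_abs_le (bs i).b
    rw [hbs']
    dsimp only [BoxSpec.Inside]
    refine ⟨by omega, by omega, by omega, by omega⟩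
  have hsize : ∀ i, n₀ ≤ (bs' i).w ∧ n₀ ≤ (bs' i).h := fun i => by
    rw [hbs']
    exact ⟨hn.trans (hbs i).1, hn.trans (hbs i).2⟩
  -- recentring
  have hrec : μIK.real (⋂ i, boxEvent S (bs i)) = μIK.real (⋂ i, boxEvent S' (bs' i)) := by
    rw [hbs', hS']
    exact real_iInter_boxEvent_recentre S a₀ b₀ k bs
  have hprob : ∀ i, boxProb S (bs i) = boxProb S' (bs' i) := fun i => by
    rw [hbs', hS']
    exact boxProb_recentre S a₀ b₀ (bs i)
  rw [hrec, Finset.prod_congr rfl fun i _ => hprob i, quenched_bridge_family S' W H k bs' hin]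
  have hF : facesIn S' (cellRect 0 0 W H) ⊆ innerVertices (cellRect 0 0 W H) := facesIn_subset_innerVertices _ _
  -- STEP 2: the annealed bound, coin by coin
  have hA : AnnealedQuenchedBound := stub_annealedQuenchedBound hM hH
  have hstep2 : ∑ c ∈ (facesIn S' (cellRect 0 0 W H)).powerset, ((1 : ℝ) / 2) ^ (facesIn S' (cellRect 0 0 W H)).card *
      ∑ D ∈ (facesIn S' (cellRect 0 0 W H)).powerset, ∑ v ∈ patterns D, envW S' (cellRect 0 0 W H) D *
        ∏ i, quenchedBoxProb S' (cellRect 0 0 W H) (bs' i) D v c ≤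
      ∑ c ∈ (facesIn S' (cellRect 0 0 W H)).powerset, ((1 : ℝ) / 2) ^ (facesIn S' (cellRect 0 0 W H)).card *
        (colourLaw S' (cellRect 0 0 W H) ((fun s => boxFill (cellRect 0 0 W H) (fun _ => false) s) ''
          ↑((cellRect 0 0 W H).powerset.filter fun s => ∀ i, s ∈ boxFamily S' (cellRect 0 0 W H) (bs' i) c))).toReal :=
    Finset.sum_le_sum fun c _ => mul_le_mul_of_nonneg_left
      (hA S' (cellRect 0 0 W H) k (fun i => boxFamily S' (cellRect 0 0 W H) (bs' i) c)
        fun i => boxFamily_upper S' (cellRect 0 0 W H) (bs' i) c) (by positivity)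
  -- STEP 3: telescoping over the probability space (coins × (defects, pattern))
  have hπ : ∀ j ∈ (facesIn S' (cellRect 0 0 W H)).powerset ×ˢ (facesIn S' (cellRect 0 0 W H)).powerset.sigma
      (fun D => patterns D), 0 ≤ ((1 : ℝ) / 2) ^ (facesIn S' (cellRect 0 0 W H)).card * envW S' (cellRect 0 0 W H) j.2.1 := by
    intro j hj
    obtain ⟨-, hj2⟩ := Finset.mem_product.1 hj
    obtain ⟨-, hv⟩ := Finset.mem_sigma.1 hj2
    exact mul_nonneg (by positivity) (envW_nonneg S' _ hv)
  have hπ1 : ∑ j ∈ (facesIn S' (cellRect 0 0 W H)).powerset ×ˢ (facesIn S' (cellRect 0 0 W H)).powerset.sigma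
      (fun D => patterns D), ((1 : ℝ) / 2) ^ (facesIn S' (cellRect 0 0 W H)).card * envW S' (cellRect 0 0 W H) j.2.1 = 1 := by
    have h := sum_env_eq S' (cellRect 0 0 W H) (((1 : ℝ) / 2) ^ (facesIn S' (cellRect 0 0 W H)).card) fun _ _ _ => 1
    simp only [mul_one] at h
    rw [← h]
    exact sum_env_one hM S' (cellRect 0 0 W H)
  have hX : ∀ (i : Fin k), ∀ j ∈ (facesIn S' (cellRect 0 0 W H)).powerset ×ˢ (facesIn S' (cellRect 0 0 W H)).powerset.sigma
      (fun D => patterns D), 0 ≤ quenchedBoxProb S' (cellRect 0 0 W H) (bs' i) j.2.1 j.2.2 j.1 ∧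
        quenchedBoxProb S' (cellRect 0 0 W H) (bs' i) j.2.1 j.2.2 j.1 ≤ 1 := by
    intro i j hj
    obtain ⟨-, hj2⟩ := Finset.mem_product.1 hj
    obtain ⟨hD, hv⟩ := Finset.mem_sigma.1 hj2
    have hDin : j.2.1 ⊆ innerVertices (cellRect 0 0 W H) := (Finset.mem_powerset.1 hD).trans hF
    exact ⟨quenchedProb_nonneg _ hv _, (quenchedProb_mono _ hv (boxFamily_subset S' _ (bs' i) j.1)).trans_eq
      (quenchedProb_powerset _ _ hDin _ hv)⟩
  have hp : ∀ i : Fin k, 0 ≤ boxProb S' (bs' i) ∧ boxProb S' (bs' i) ≤ 1 := fun i =>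
    ⟨measureReal_nonneg, measureReal_le_one⟩
  have key := telescoping_sqrt_bound _ _ hπ hπ1 k (fun i j => quenchedBoxProb S' (cellRect 0 0 W H) (bs' i) j.2.1 j.2.2 j.1)
    (fun i => boxProb S' (bs' i)) hX hp
  rw [← sum_env_eq S' (cellRect 0 0 W H) _ fun c D v => ∏ i, quenchedBoxProb S' (cellRect 0 0 W H) (bs' i) D v c] at key
  have hvar : ∀ i : Fin k, ∑ j ∈ (facesIn S' (cellRect 0 0 W H)).powerset ×ˢ (facesIn S' (cellRect 0 0 W H)).powerset.sigma
      (fun D => patterns D), ((1 : ℝ) / 2) ^ (facesIn S' (cellRect 0 0 W H)).card * envW S' (cellRect 0 0 W H) j.2.1 *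
        (quenchedBoxProb S' (cellRect 0 0 W H) (bs' i) j.2.1 j.2.2 j.1 - boxProb S' (bs' i)) ^ 2 =
      envVariance S' (cellRect 0 0 W H) (bs' i) := fun i => by
    rw [envVariance, sum_env_eq S' (cellRect 0 0 W H) _ fun c D v =>
      (quenchedBoxProb S' (cellRect 0 0 W H) (bs' i) D v c - boxProb S' (bs' i)) ^ 2]
  simp only [hvar] at key
  -- STEP 4: the variance bound
  have hstep4 : ∑ i, Real.sqrt (envVariance S' (cellRect 0 0 W H) (bs' i)) ≤ η := by
    calc ∑ i, Real.sqrt (envVariance S' (cellRect 0 0 W H) (bs' i)) ≤ ∑ _i : Fin k, η / (k + 1) :=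
          Finset.sum_le_sum fun i _ => (Real.sqrt_le_left (by positivity)).2
            (hn₀ S' 0 0 W H (bs' i) (hsize i).1 (hsize i).2 (hin i))
      _ = k * (η / (k + 1)) := by simp
      _ ≤ η := by
          rw [← mul_div_assoc, div_le_iff₀ (by positivity)]
          nlinarith
  linarith [hstep2, key, hstep4]

end Summit.CriticalPhenomena.CardyFormulaZ2.Cruxes.IKMixedBoxCrossing.QuenchedChainFKG

end
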